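import Literature.NumberTheory.EllipticCurves.HeathBrown1994.CongruentTwoSelmerMonskyMatrix
import Mathlib.LinearAlgebra.Matrix.Determinant.Basic
import Mathlib.Data.Fintype.BigOperators
import HarnessLib

/-!
# Route `PrintCf2`, crux stmt-BirchSwinnertonDyer-20509 `RamifiedOffTYZOfFacts` — DEFINITIONS for the Q-FORM IDENTITY (★)
# (cell `bsd-print-cf2`, LEAD of 20509 g5, line `offtyz-v7`, cycle 6; route-posited objects, DEFINITIONS ONLY — nothing asserted)

This file makes the CONJECTURE (★) of the LEAD note `Cruxes/RamifiedOffTYZOfFacts/Lines/offtyz_v7_QForm.md` NAMEABLE by the route: it defines,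
purely in terms of the tree's Monsky data (`HeathBrown1994.legendreMatrix`, `legendreDiagonal`, `monskyMatrixOdd`), the kernel sums, the block
Rédei data and the two sides of (★), so that the planner can STATE (★) by name (the `Prop`s `QFormIdentity` — coefficient form (★a) ∧ (★b) —, `QFormIdentityOmega`
— Ω-form, note §11 — and the corollary `QFormNonvanishing` the Galois-mover door needs are kept in the crux workfile
`Lines/offtyz_v7_QForm.lean`, since conjectures are filed by the planner, not by this seat). NOTHING IS ASSERTED here; the kernel helpers `…MonskyRedeiForm` (p676494) and `…RealRedeiKernel` (p678165) prove the linear algebra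
around them, and the crux workfile `Lines/offtyz_v7_QForm.lean` carries closed sanity evaluations (n = 5, 21, 221, 165, 1645).

MEANING (note §1–§3, §8, paper level, from TYZ 2017 §3 as printed + Hochschild–Serre + class field theory of the conductor-2 / -4 ring class
fields): for square-free `n = p₁⋯p_k ≡ 5 (mod 8)` the Galois-mover class of TYZ's genus point `P(n)` over `F = ℚ(i, √p₁, …, √p_k)` has an
invariant `Q_n ∈ H²(Gal(F/ℚ), 𝔽₂) = 𝔽₂[x_{−1}, x_{p₁}, …, x_{p_k}]₂` with «mover ⟺ Q_n ≠ 0», and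
`Q_n = Σ_{d ∣ n, d ≡ 5 (8), 𝓛(n/d) odd, corank A_d = 1} x_{D₁(d)} x_{D₂(d)}` (Rédei decomposition of the second kind of −16d).
(★) says `Q_n = q(κ_n)`, `κ_n = Σ_{v ∈ ker M_n} v = (d₊; d₋)`, `q = x_{[x]}x_{n/[x]} + x_{−1}x_{[x−n]}` — coefficientwise (★a)/(★b) below, with
«𝓛(n/d) odd» typed as «det M_{n/d} = 1» (Smith 2016 Thm 1.2 + TYZ Thm 1.1, both in print). EVIDENCE: 0 exceptions on all 14 893 Legendre
sign patterns with k ≤ 5 and 50 000 random ones with k ≤ 8 (instrument `qform.py`, evidence on 20509). CONSEQUENCE granted (★) + the note's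
§1–§3: every square-free n ≡ 5 (mod 8) with `#Sel₂(E_n) = 8` has a mover, hence (door p672160) `𝓛(n)` odd, `ord = rank = 1`, `Ш[2^∞] = 0`,
`BSD(E_n, 2)`. BSD is not proved by any of this; nothing is asserted in this file.

References: [cite: HeathBrown1994SelmerCongruentII, Appendix (Monsky), typescript p. 39 L10–L33]; [cite: Smith2016CongruentDensity, Thm 1.2, Thm 2.2];
[cite: TianYuanZhang2017, Thm. 1.1, §3.1, Thm. 3.5].
-/

namespace Summit.BirchSwinnertonDyer.PrintCf2.QForm

open Finset Matrix Literature.NumberTheory.EllipticCurves.HeathBrown1994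

variable {k : ℕ}

/-- Sum of all vectors of the right kernel of a square matrix over `𝔽₂`: the null vector when the corank is `1`, `0` otherwise
(a subspace of dimension `≠ 1` sums to `0`). [folklore] -/
def kerSum {m : Type*} [Fintype m] [DecidableEq m] (M : Matrix m m (ZMod 2)) : m → ZMod 2 :=
  ∑ v : m → ZMod 2, if M.mulVec v = 0 then v else 0

/-- Sum of all vectors of the LEFT kernel (`uᵀ M = 0`). [folklore] -/
def leftKerSum {m : Type*} [Fintype m] [DecidableEq m] (M : Matrix m m (ZMod 2)) : m → ZMod 2 :=
  kerSum Mᵀ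

/-- Monsky's kernel sum `κ_n = (a; b)` of `M_n = monskyMatrixOdd p`. [cite: HeathBrown1994SelmerCongruentII, Appendix (Monsky), typescript p. 39 L27–L33] -/
def kappa (p : Fin k → ℕ) : Fin k ⊕ Fin k → ZMod 2 :=
  kerSum (monskyMatrixOdd p)

/-- `a`-part of `κ_n` (Monsky's first block: the class of `x + n`). [cite: HeathBrown1994SelmerCongruentII, Appendix (Monsky), typescript p. 39 L27–L33] -/
def kappaA (p : Fin k → ℕ) (i : Fin k) : ZMod 2 := kappa p (Sum.inl i)

/-- `b`-part of `κ_n` (Monsky's second block: the class of `x`). [cite: HeathBrown1994SelmerCongruentII, Appendix (Monsky), typescript p. 39 L27–L33] -/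
def kappaB (p : Fin k → ℕ) (i : Fin k) : ZMod 2 := kappa p (Sum.inr i)

/-- The primes of a sub-block `S ⊆ {p₁, …, p_k}` re-indexed by `Fin #S` (increasing order; any re-indexing conjugates the matrices
by a permutation and changes neither determinants nor kernel sums read back on `S`). [folklore] -/
def blockPrimes (p : Fin k → ℕ) (S : Finset (Fin k)) : Fin S.card → ℕ := fun t => p (S.orderIsoOfFin rfl t)

/-- Rédei/Monsky matrix `A_d` of the sub-block `d = ∏_{i ∈ S} pᵢ` (diagonal recomputed inside the block).
[cite: HeathBrown1994SelmerCongruentII, Appendix (Monsky), typescript p. 39 L13–L26] -/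
def blockLegendreMatrix (p : Fin k → ℕ) (S : Finset (Fin k)) : Matrix (Fin S.card) (Fin S.card) (ZMod 2) :=
  legendreMatrix (blockPrimes p S)

/-- Monsky's matrix of the complementary block `n/d`. [cite: HeathBrown1994SelmerCongruentII, Appendix (Monsky), typescript p. 39 L27–L33] -/
def coblockMonsky (p : Fin k → ℕ) (S : Finset (Fin k)) :
    Matrix (Fin Sᶜ.card ⊕ Fin Sᶜ.card) (Fin Sᶜ.card ⊕ Fin Sᶜ.card) (ZMod 2) :=
  monskyMatrixOdd (blockPrimes p Sᶜ)

/-- The weight `σ(n/d) := det M_{n/d} ∈ 𝔽₂` (`= [s(n/d) = 0]` = `[𝓛(n/d) odd]` by Smith 2016 Thm 1.2; `det` of the empty matrix is `1`).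
[cite: Smith2016CongruentDensity, Thm 1.2 and Thm 2.2] -/
def coblockWeight (p : Fin k → ℕ) (S : Finset (Fin k)) : ZMod 2 :=
  (coblockMonsky p S).det

/-- The corank-one left null vector `u_d` of `A_d` as the LEFT kernel sum (automatically `0` when the corank is `≥ 2`;
corank `0` never occurs since the row sums of `A_d` vanish), extended by `0` outside the block. [folklore] -/
def blockNull (p : Fin k → ℕ) (S : Finset (Fin k)) (i : Fin k) : ZMod 2 :=
  if h : i ∈ S then leftKerSum (blockLegendreMatrix p S) ((S.orderIsoOfFin rfl).symm ⟨i, h⟩) else 0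

/-- `ε_d := Σ_{i ∈ d} u_{d,i} · (−1/pᵢ)_+` (parity of the number of primes `≡ 3 (mod 4)` in `D₁(d)`; the sign of `D₁`). [folklore] -/
def blockSign (p : Fin k → ℕ) (S : Finset (Fin k)) : ZMod 2 :=
  ∑ i ∈ S, blockNull p S i * addLegendreSym (-1) (p i)

/-- The admissible blocks: `d = ∏_{i∈S} pᵢ ≡ 5 (mod 8)` (for `n ≡ 5 (mod 8)` this forces `n/d ≡ 1 (mod 8)`), as a Boolean test. [folklore] -/
def admissible (p : Fin k → ℕ) (S : Finset (Fin k)) : Bool :=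
  decide ((∏ i ∈ S, p i) % 8 = 5)

/-- Right side of (★b) at the prime `pᵢ`: the `x_{−1}x_{pᵢ}`-coefficient of `Q_n`,
`Σ_{d admissible} det(M_{n/d}) · (u_{d,i} + ε_d [pᵢ ∣ d])`. [folklore] -/
def rhsB (p : Fin k → ℕ) (i : Fin k) : ZMod 2 :=
  ∑ S ∈ (Finset.univ : Finset (Finset (Fin k))).filter (fun S => admissible p S),
    coblockWeight p S * (blockNull p S i + (if i ∈ S then blockSign p S else 0))

/-- Right side of (★a) at the pair `pᵢ, p_j`: the `x_{pᵢ}x_{p_j}`-coefficient of `Q_n`,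
`Σ_{d admissible} det(M_{n/d}) · (u_{d,i}[p_j ∣ d] + u_{d,j}[pᵢ ∣ d])`. [folklore] -/
def rhsA (p : Fin k → ℕ) (i j : Fin k) : ZMod 2 :=
  ∑ S ∈ (Finset.univ : Finset (Finset (Fin k))).filter (fun S => admissible p S),
    coblockWeight p S * ((if j ∈ S then blockNull p S i else 0) + (if i ∈ S then blockNull p S j else 0))

end Summit.BirchSwinnertonDyer.PrintCf2.QForm

/-! ## The Ω-form of (★) (note §11): real Rédei null vectors of the blocks, Monsky determinants of the co-blocks -/

namespace Summit.BirchSwinnertonDyer.PrintCf2.QForm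

open Finset Matrix Literature.NumberTheory.EllipticCurves.HeathBrown1994

variable {k : ℕ}

/-- The REAL Rédei matrix `N_d = A_d + D₋₁` of the block `d` (`= A_dᵀ + c₋₁c₋₁ᵀ` by quadratic reciprocity, landed as
`MonskyRedeiForm.legendreMatrix_transpose`). [folklore] -/
def blockRealRedei (p : Fin k → ℕ) (S : Finset (Fin k)) : Matrix (Fin S.card) (Fin S.card) (ZMod 2) :=
  legendreMatrix (blockPrimes p S) + legendreDiagonal (blockPrimes p S) (-1)

/-- `ρ(N_d)`: the right kernel sum of the real Rédei matrix of the block, read back on `Fin k` (zero outside the block). For `d ≡ 5 (8)`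
it equals `u_d + ε_d·1_d` (note §11). [folklore] -/
def blockRho (p : Fin k → ℕ) (S : Finset (Fin k)) (i : Fin k) : ZMod 2 :=
  if h : i ∈ S then kerSum (blockRealRedei p S) ((S.orderIsoOfFin rfl).symm ⟨i, h⟩) else 0

/-- **`Ω_n := Σ_{d admissible} det(M_{n/d}) · ρ(N_d) · 1_dᵀ`** (a `k × k` matrix over `𝔽₂`). [folklore] -/
def Omega (p : Fin k → ℕ) : Matrix (Fin k) (Fin k) (ZMod 2) :=
  Matrix.of fun i j => ∑ S ∈ (Finset.univ : Finset (Finset (Fin k))).filter (fun S => admissible p S),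
    coblockWeight p S * blockRho p S i * (if j ∈ S then 1 else 0)

end Summit.BirchSwinnertonDyer.PrintCf2.QForm
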